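import Mathlib

/-!
# idea-11 g4 — LINE idea11-L3 «SHADOW LADDER»: abstract soundness + same-window monotonicity

Abstract moment-vector setting (as in the lineage's Sketch/Sketch2): `K` word coordinates of an open window,
`M : Set (K → ℝ)` the moment vectors of genuine window states (the complete local state cone section),
`R ⊇ M` the relaxation's feasible window moments, `y ∈ R` the optimum of record.
A SHADOW is a coordinate subset `S : Set K` (words of a commuting / one-species sub-algebra); a shadow cut is a
valid cut whose coefficient vector is supported on `S`.  Everything here is bookkeeping that the harness wants
spelled out: (1) a shadow cut is a full cut (so adding it keeps soundness), (2) the best normalised violation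
achievable inside a shadow never exceeds the full-algebra one at the same window (the same-window tripwire
`ν_shadow(3×4) ≤ ν_G3(3×4)` of STATUS l.845), (3) if the full cone has NO cut at a window, no shadow has one.
HONEST FRAMING: no Hubbard-specific content; nothing here is a bound on anything.
-/

namespace Summit.Ventures.CertifiedManyBodySolver.Cruxes.LowerEdge_ge_m4o5.ShadowLadder

variable {K : Type*} [Fintype K]

/-- the linear functional of a cut vector `g` on a moment vector `m` -/
def pair (g m : K → ℝ) : ℝ := ∑ k, g k * m k

/-- `(g, L)` is a VALID cut for the state-moment set `M`: every genuine state satisfies `L ≤ ⟪g, m⟫`. -/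
def ValidCut (M : Set (K → ℝ)) (g : K → ℝ) (L : ℝ) : Prop := ∀ m ∈ M, L ≤ pair g m

/-- `g` lives in the shadow `S` (coefficients vanish outside `S`). -/
def InShadow (S : Set K) (g : K → ℝ) : Prop := ∀ k, k ∉ S → g k = 0

/-- violation of the cut at the relaxation optimum `y` (positive iff the cut separates `y` from `M`) -/
def viol (g : K → ℝ) (L : ℝ) (y : K → ℝ) : ℝ := L - pair g y

/-- (1) SOUNDNESS: intersecting the relaxation with any family of valid cuts keeps every genuine state feasible,
so the relaxation minimum of a linear objective stays a lower bound of the true minimum over `M`. -/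
theorem relaxation_with_validCuts_sound (M R : Set (K → ℝ)) (hMR : M ⊆ R)
    (ι : Type*) (g : ι → K → ℝ) (L : ι → ℝ) (hvalid : ∀ i, ValidCut M (g i) (L i))
    (c : K → ℝ) (v : ℝ) (hv : ∀ r ∈ R, (∀ i, L i ≤ pair (g i) r) → v ≤ pair c r) :
    ∀ m ∈ M, v ≤ pair c m := by
  intro m hm
  exact hv m (hMR hm) (fun i => hvalid i m hm)

/-- (2) SAME-WINDOW MONOTONICITY: whatever violation a shadow-supported valid cut achieves at `y`, some full-algebra
valid cut achieves at least as much (the shadow family is a sub-family).  Contrapositive = the tripwire: a shadow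
violation exceeding the certified full-algebra separation depth at the same window is a bookkeeping error. -/
theorem shadow_viol_le_full (M : Set (K → ℝ)) (S : Set K) (y : K → ℝ) (g : K → ℝ) (L : ℝ)
    (_hS : InShadow S g) (hvalid : ValidCut M g L) (B : ℝ)
    (hB : ∀ g' : K → ℝ, ∀ L' : ℝ, ValidCut M g' L' → viol g' L' y ≤ B) :
    viol g L y ≤ B := hB g L hvalid

/-- (3) NO FULL CUT ⇒ NO SHADOW CUT: if `y` is in the complete local cone section (`y ∈ M`, i.e. the window marginal
of the optimum is exactly representable), then no valid cut — in particular no shadow cut — has positive violation. -/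
theorem no_shadow_cut_of_representable (M : Set (K → ℝ)) (y : K → ℝ) (hy : y ∈ M)
    (g : K → ℝ) (L : ℝ) (hvalid : ValidCut M g L) : viol g L y ≤ 0 := by
  have := hvalid y hy
  unfold viol; linarith

/-- (4) SHADOW EXACTNESS (the reason the shadow oracle is COMPLETE, abstractly): if the shadow coordinates of every
genuine state moment vector are mixtures of finitely many "configuration" vectors `e c` (classical configurations for
the DIAG shadow; sector eigen-moments for the UP shadow), then a shadow-supported `g` is a valid cut with constant
`L = min_c ⟪g, e c⟫` — the number the column-DP / spinless-Lanczos oracle computes. -/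
theorem shadowCut_valid_of_mixture {C : Type*} [Fintype C] [Nonempty C]
    (M : Set (K → ℝ)) (S : Set K) (e : C → K → ℝ) (g : K → ℝ) (hS : InShadow S g)
    (hmix : ∀ m ∈ M, ∃ p : C → ℝ, (∀ c, 0 ≤ p c) ∧ ∑ c, p c = 1 ∧ ∀ k ∈ S, m k = ∑ c, p c * e c k) :
    ValidCut M g (Finset.univ.inf' Finset.univ_nonempty (fun c => pair g (e c))) := by
  intro m hm
  obtain ⟨p, hp0, hp1, hpm⟩ := hmix m hm
  -- ⟪g, m⟫ = Σ_c p_c ⟪g, e c⟫ because g vanishes off S and m agrees with the mixture on S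
  have key : pair g m = ∑ c, p c * pair g (e c) := by
    unfold pair
    have h1 : ∀ k, g k * m k = ∑ c, p c * (g k * e c k) := by
      intro k
      by_cases hk : k ∈ S
      · rw [hpm k hk, Finset.mul_sum]
        refine Finset.sum_congr rfl (fun c _ => by ring)
      · simp [hS k hk]
    simp_rw [h1]
    rw [Finset.sum_comm]
    refine Finset.sum_congr rfl (fun c _ => by rw [Finset.mul_sum])
  rw [key]
  set Lmin := Finset.univ.inf' Finset.univ_nonempty (fun c => pair g (e c)) with hL
  calc Lmin = ∑ c, p c * Lmin := by rw [← Finset.sum_mul, hp1, one_mul]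
    _ ≤ ∑ c, p c * pair g (e c) := by
        apply Finset.sum_le_sum
        intro c _
        exact mul_le_mul_of_nonneg_left (Finset.inf'_le _ (Finset.mem_univ c)) (hp0 c)

end Summit.Ventures.CertifiedManyBodySolver.Cruxes.LowerEdge_ge_m4o5.ShadowLadder
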